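import Literature.Geometry.Lorentzian.TeukolskyRadialFluxInfinity
import Literature.Geometry.Lorentzian.KerrSurfaceGravity
import Literature.Geometry.Lorentzian.KerrSeparatedPotential

/-!
# The Wronskian lower bound in the easy regime: non-superradiant cone frequencies off the
# threshold sliver (stub `stub_wronskianFluxRegime`, S4a of the line `olver-dunster-uniform-reduction`)

Crux `PhaseMixingCapture.KappaExplicitWaveDecay` (stmt-FinalStateConjecture-10654), line
`olver-dunster-uniform-reduction`, stub S4a. For `M > 0` and every sliver width `δ > 0` there are
`a₁ < M`, `ε₀ > 0`, `C > 0`, `N` (here `a₁ = M/2`, `ε₀ = 1/(16M)`, `C = 1 + δ⁻¹`, `N = 1`) such that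
for `a₁ ≤ |a| < M`, admissible `(ω, m, Λ)` with `m ≠ 0` in the cone `|ω − mω₊| ≤ ε₀|m|` which are
NON-superradiant, `ω(ω − mω₊) ≥ 0`, and OFF the sliver, `|ω − mω₊| ≥ δκ` (`κ = Kerr.surfaceGravity M a`),
and for the normalised pair `R_𝓗`, `R_𝓘` (TdC Def. 2.3, `s = 0`, `λ = Λ − a²ω²`):
`1 ≤ (C|m|^N κ^{-N})² · |𝔚(r)|²` at every `r > r₊`.

It is a corollary of the landed flux layer (`Literature/Geometry/Lorentzian/TeukolskyRadialFlux(Infinity).lean`):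

* the energy identity for the normalised pair gives `|𝔚|² ≥ 4ω(ω − mω₊)`
  (`Kerr.Costa2019.four_mul_omega_mul_le_norm_sq_radialWronskian`, TdC Prop. 2.20);
* in the cone, `|ω| ≥ (a₁/(4M²) − ε₀)|m| = |m|/(16M)` (`Kerr.Costa2019.abs_omega_lower_of_cone`), so
  `ω ≠ 0` (as `|m| ≥ 1`) and `ω(ω − mω₊) = |ω|·|ω − mω₊| ≥ |m|δκ/(16M)`;
* with `κ ≤ 1/(4M)` (`Kerr.surfaceGravity_le`) and `κ > 0` (`Kerr.IsSubextremal.surfaceGravity_pos`):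
  `(C|m|κ⁻¹)²|𝔚|² ≥ C²|m|³δ/(4Mκ) ≥ C²δ|m|³ ≥ C²δ ≥ 1` for `C = 1 + δ⁻¹`.

Pure bookkeeping over two landed lemmas; no unproved fact is used.
-/

-- the doubled `FinalStateConjecture.FinalStateConjecture` path component trips dupNamespace
set_option linter.dupNamespace false

noncomputable section

namespace Summit.FinalStateConjecture.FinalStateConjecture.Theorems.KappaExplicitWaveDecay.OlverDunsterUniformReduction

open Literature.Geometry.Lorentzian
open MeasureTheory Filter Set Complex
open scoped Topology Manifold ENNReal

/-- The final arithmetic step: if `0 < δ`, `0 < M`, `0 < k ≤ 1/(4M)`, `1 ≤ μ` and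
`μδk/(4M) ≤ w`, then `1 ≤ ((1 + δ⁻¹) μ k⁻¹)² w`. -/
private theorem one_le_sq_mul_of_bounds {δ M k μ w : ℝ} (hδ : 0 < δ) (hM : 0 < M) (hk : 0 < k)
    (hk4 : k ≤ 1 / (4 * M)) (hμ : 1 ≤ μ) (hw : μ * δ * k / (4 * M) ≤ w) :
    1 ≤ ((1 + 1 / δ) * μ ^ 1 * k⁻¹ ^ 1) ^ 2 * w := by
  set C : ℝ := 1 + 1 / δ with hC
  have hC1 : 1 ≤ C := le_add_of_nonneg_right (by positivity)
  have hCδ : 1 ≤ C * δ := by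
    rw [hC, add_mul, one_mul, one_div, inv_mul_cancel₀ hδ.ne']
    linarith
  have hC2δ : 1 ≤ C ^ 2 * δ := by
    rw [sq, mul_assoc]
    exact one_le_mul_of_one_le_of_one_le hC1 hCδ
  have hμ3 : (1 : ℝ) ≤ μ ^ 3 := one_le_pow₀ hμ
  have h1 : 1 ≤ C ^ 2 * δ * μ ^ 3 := one_le_mul_of_one_le_of_one_le hC2δ hμ3
  have hk0 : k ≠ 0 := hk.ne'
  have hμ0 : 0 ≤ μ := zero_le_one.trans hμ
  -- reduce to `k² ≤ C² μ² w`
  have key : k ^ 2 ≤ C ^ 2 * μ ^ 2 * w := by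
    calc k ^ 2 = k * k := sq k
      _ ≤ 1 / (4 * M) * k := by gcongr
      _ = 1 * k / (4 * M) := by ring
      _ ≤ C ^ 2 * δ * μ ^ 3 * k / (4 * M) := by gcongr
      _ = C ^ 2 * μ ^ 2 * (μ * δ * k / (4 * M)) := by ring
      _ ≤ C ^ 2 * μ ^ 2 * w := by gcongr
  have hexpr : (C * μ ^ 1 * k⁻¹ ^ 1) ^ 2 * w = C ^ 2 * μ ^ 2 * w / k ^ 2 := by
    simp only [pow_one]
    field_simp
  rw [hexpr, le_div_iff₀ (by positivity), one_mul]
  exact key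

/-- **S4a · `stub_wronskianFluxRegime` — the DENOMINATOR in the easy regime: κ-polynomial
Wronskian lower bound for NON-SUPERRADIANT cone frequencies OFF the threshold sliver.** For `M > 0`
and every `δ > 0` there are `a₁ < M`, `ε₀ > 0`, `C > 0`, `N` (namely `a₁ = M/2`, `ε₀ = 1/(16M)`,
`C = 1 + δ⁻¹`, `N = 1`) such that for `a₁ ≤ |a| < M`, admissible `(ω, m, Λ)` with `m ≠ 0`,
`|ω − mω₊| ≤ ε₀|m|`, `δκ ≤ |ω − mω₊|`, `0 ≤ ω(ω − mω₊)`, and the normalised pair `R_𝓗`, `R_𝓘` of the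
`s = 0` radial Teukolsky ODE with `λ = Λ − a²ω²`: `1 ≤ (C|m|^N κ^{-N})²·|𝔚(R_𝓗, R_𝓘)(r)|²` for all
`r > r₊`. Corollary of `Kerr.Costa2019.four_mul_omega_mul_le_norm_sq_radialWronskian` (TdC 2020,
Prop. 2.20) and `Kerr.Costa2019.abs_omega_lower_of_cone`. -/
theorem stub_wronskianFluxRegime :
    (∀ M : ℝ, 0 < M → ∀ δ : ℝ, 0 < δ → ∃ (a₁ ε₀ C : ℝ) (N : ℕ), a₁ < M ∧ 0 < ε₀ ∧ 0 < C ∧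
      ∀ a : ℝ, a₁ ≤ |a| → Kerr.IsSubextremal M a →
        ∀ (ω : ℝ) (m : ℤ) (Λ : ℝ), Kerr.IsAdmissibleTriple a ω m Λ → m ≠ 0 →
          |ω - m * Kerr.horizonAngularVelocity M a| ≤ ε₀ * |(m : ℝ)| →
          δ * Kerr.surfaceGravity M a ≤ |ω - m * Kerr.horizonAngularVelocity M a| →
          0 ≤ ω * (ω - m * Kerr.horizonAngularVelocity M a) →
            ∀ RH RI : ℝ → ℂ,
              Kerr.IsRadialTeukolskySolution M a 0 ω m (Λ - a ^ 2 * ω ^ 2) RH →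
              Kerr.IsNormalisedHorizonSolution M a 0 ω m RH →
              Kerr.IsRadialTeukolskySolution M a 0 ω m (Λ - a ^ 2 * ω ^ 2) RI →
              Kerr.IsNormalisedInfinitySolution M 0 ω RI →
                ∀ r : ℝ, Kerr.rPlus M a < r →
                  1 ≤ (C * |(m : ℝ)| ^ N * (Kerr.surfaceGravity M a)⁻¹ ^ N) ^ 2 *
                    ‖Kerr.radialWronskian M a 0 RH RI r‖ ^ 2) := by
  intro M hM δ hδ
  refine ⟨M / 2, 1 / (16 * M), 1 + 1 / δ, 1, by linarith, by positivity, by positivity, ?_⟩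
  intro a ha₁ ha ω m Λ _ hm hcone hsliver hnon RH RI hH hnH hI hnI r hr
  have haM : |a| < M := ha
  -- surface gravity: `0 < κ ≤ 1/(4M)`
  have hκ : 0 < Kerr.surfaceGravity M a := ha.surfaceGravity_pos
  have hκ4 : Kerr.surfaceGravity M a ≤ 1 / (4 * M) := Kerr.surfaceGravity_le hM a
  -- `|m| ≥ 1`
  have hμ : (1 : ℝ) ≤ |(m : ℝ)| := by exact_mod_cast Int.one_le_abs hm
  -- the cone stays away from `ω = 0`: `|ω| ≥ |m|/(16M)`
  have hω : 1 / (16 * M) * |(m : ℝ)| ≤ |ω| := by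
    have h := Kerr.Costa2019.abs_omega_lower_of_cone hM (half_pos hM) ha₁ hcone
    have e : M / 2 / (4 * M ^ 2) - 1 / (16 * M) = 1 / (16 * M) := by
      field_simp
      ring
    rwa [e] at h
  have hω0 : ω ≠ 0 := by
    have h0 : 0 < 1 / (16 * M) * |(m : ℝ)| := mul_pos (by positivity) (by linarith)
    exact abs_pos.mp (h0.trans_le hω)
  -- the energy identity for the normalised pair: `4ω(ω − mω₊) ≤ |𝔚|²`
  have hW := Kerr.Costa2019.four_mul_omega_mul_le_norm_sq_radialWronskian hM haM hω0 hH hnH hI hnI hr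
  -- non-superradiance: `ω(ω − mω₊) = |ω|·|ω − mω₊| ≥ (|m|/(16M))·(δκ)`
  have hprod : |ω| * |ω - m * Kerr.horizonAngularVelocity M a| =
      ω * (ω - m * Kerr.horizonAngularVelocity M a) := by
    rw [← abs_mul, abs_of_nonneg hnon]
  have hlow : 1 / (16 * M) * |(m : ℝ)| * (δ * Kerr.surfaceGravity M a) ≤
      ω * (ω - m * Kerr.horizonAngularVelocity M a) := by
    rw [← hprod]
    exact mul_le_mul hω hsliver (by positivity) (abs_nonneg _)
  have hw : |(m : ℝ)| * δ * Kerr.surfaceGravity M a / (4 * M) ≤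
      ‖Kerr.radialWronskian M a 0 RH RI r‖ ^ 2 := by
    have e : |(m : ℝ)| * δ * Kerr.surfaceGravity M a / (4 * M) =
        4 * (1 / (16 * M) * |(m : ℝ)| * (δ * Kerr.surfaceGravity M a)) := by
      field_simp
      ring
    rw [e]
    linarith
  exact one_le_sq_mul_of_bounds hδ hM hκ hκ4 hμ hw

end Summit.FinalStateConjecture.FinalStateConjecture.Theorems.KappaExplicitWaveDecay.OlverDunsterUniformReduction
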